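import Mathlib.Algebra.Group.Subgroup.Map
import Mathlib.SetTheory.Cardinal.Finite
import HarnessLib

/-!
# Transport of «stable subgroups of order `r` made of torsion points» along an equivariant isomorphism of groups
# ([Tate1997FiniteFlatGroupSchemes] (3.7); [BourbakiAlgebraI1989] Ch. I §4 nos. 2–3: groups with operators, stable subgroups)

Topic `Literature/GroupTheory`; namespace `Literature.GroupTheory.StableSubgroups`.  THEOREMS ONLY, Mathlib-only (`Subgroup.map`, `MulEquiv.subgroupMap`,
`Subgroup.mem_map_equiv`); no definition, no instance, no notation, no named fact, no `sorry`.  Cell `hodgecm-mathlib` (D-0151), programme P6 «MOD» (crux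
hLiu418 = stmt-HodgeConjecture-24832, `--supports`, count-neutral): organ **(TR) «TRANSPORT OF THE `LineOf` COUNT»** (LA1-p04 (g0) 2026-09-02, GENERIC-FIBRE road,
sequel of ★ (GF) `IdealTorsionGenericFibreEtale` and ★ (L-q-sub) `IdealTorsionStableSubgroups`): the D-line carrier
`LineOf I y = {H : Subgroup (A_y(Ω)) // Nat.card H = q ∧ (∀ P ∈ H, IsIdealTorsionΩ … P) ∧ ∀ a, ∀ P ∈ H, P ≫ ι(a) ∈ H}`
(`Cruxes/HLiu418/Lines/F0_P6a_DatumOfInputs.lean` :206) lives on the points of the fibre `fibreΩOf … y`, while ★ (L-q-sub)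
`natCard_stableSubgroups_baseChange_eq_succ_of_forall_iff` counts the same carrier on the points of `(univ ×_𝓨 Spec R) ×_R Spec K` — two pullbacks of one
family along equal composites, canonically ISOMORPHIC (★ `AbelianSchemeBaseChangeComp.fibreBaseChangeIso`, equivariant by ★
`AbelianSchemeFibreEndomorphismOfBaseChange`), not equal.  This file moves such carriers across ANY group isomorphism `e : G₁ ≃* G₂` intertwining two
families of self-maps `f₁ a`, `f₂ a` (`e (f₁ a x) = f₂ a (e x)`) and two pointwise predicates `p₁ ↔ p₂ ∘ e` (e.g. «killed by `𝔭`»): `H ↦ e(H)` is a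
bijection between {subgroups of order `r`, all of whose elements satisfy `p₁`, stable under every `f₁ a`} and the same for `(G₂, p₂, f₂)`; so the COUNTS
agree and «another such subgroup exists» transports.  Pure group theory.  HC_CM is proved only modulo the printed citations until rung 0 closes; this
file is generic and changes no count.

## Contents
* `map_mem_iff_of_semiconj` (plumbing: `f₂ a y ∈ e(H) ↔ f₁ a (e⁻¹ y) ∈ H`), **`exists_equiv_stableSubgroups_map`** (the bijection `H ↦ H.map e`, with
  `((E H) : Subgroup G₂) = H.map e`), **`natCard_stableSubgroups_congr`** (equal counts), `exists_stableSubgroup_ne_congr` («another one» transports).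

## References
* [Tate1997FiniteFlatGroupSchemes] J. Tate, *Finite flat group schemes*, in: Modular Forms and Fermat's Last Theorem (1997), (3.7) (finite étale groups
  over `k̄` «are» their groups of points with the Galois∕endomorphism action; subgroup schemes ↔ stable subgroups).
* [BourbakiAlgebraI1989] N. Bourbaki, *Algebra I. Chapters 1–3* (1989), Ch. I §4 no. 2 (Def. 2: groups with operators; Def. 3: their homomorphisms — an
  isomorphism of groups with operators carries stable subgroups to stable subgroups) and no. 3 (Def. 4: stable subgroups).
-/

set_option autoImplicit false

namespace Literature.GroupTheory

namespace StableSubgroups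

variable {G₁ G₂ : Type*} [Group G₁] [Group G₂] (e : G₁ ≃* G₂) {σ : Type*} (f₁ : σ → G₁ → G₁) (f₂ : σ → G₂ → G₂)
  (hf : ∀ a x, e (f₁ a x) = f₂ a (e x)) (p₁ : G₁ → Prop) (p₂ : G₂ → Prop) (hp : ∀ x, p₁ x ↔ p₂ (e x))

include hf in
/-- Plumbing: for `y ∈ G₂`, `f₂ a y ∈ e(H) ↔ f₁ a (e⁻¹ y) ∈ H` (`e` intertwines `f₁ a` and `f₂ a`). [cite: BourbakiAlgebraI1989, Ch. I §4 no. 2 Def. 2–3 and no. 3 Def. 4 (groups with operators, stable subgroups)] -/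
theorem map_mem_iff_of_semiconj (H : Subgroup G₁) (a : σ) (y : G₂) :
    f₂ a y ∈ H.map e.toMonoidHom ↔ f₁ a (e.symm y) ∈ H := by
  rw [Subgroup.mem_map_equiv]
  have : e.symm (f₂ a y) = f₁ a (e.symm y) := by
    apply e.injective
    rw [e.apply_symm_apply, hf, e.apply_symm_apply]
  rw [this]

include hf hp in
/-- **TRANSPORT OF STABLE SUBGROUPS OF ORDER `r` ALONG AN EQUIVARIANT ISOMORPHISM**: `H ↦ e(H)` is a bijection between the subgroups `H ≤ G₁` of order `r`
all of whose elements satisfy `p₁` and which are stable under every `f₁ a`, and the subgroups of `G₂` of order `r` with `p₂` and `f₂`-stability — when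
`e (f₁ a x) = f₂ a (e x)` and `p₁ x ↔ p₂ (e x)`.  (For the P6 HEART: `LineOf I y` read on two isomorphic realisations of the fibre `A_y`.)
[cite: Tate1997FiniteFlatGroupSchemes, (3.7)] [cite: BourbakiAlgebraI1989, Ch. I §4 no. 2 Def. 2–3 and no. 3 Def. 4 (groups with operators, stable subgroups)] -/
theorem exists_equiv_stableSubgroups_map (r : ℕ) :
    ∃ E : {H : Subgroup G₁ // Nat.card H = r ∧ (∀ x ∈ H, p₁ x) ∧ ∀ a, ∀ x ∈ H, f₁ a x ∈ H} ≃
        {H : Subgroup G₂ // Nat.card H = r ∧ (∀ y ∈ H, p₂ y) ∧ ∀ a, ∀ y ∈ H, f₂ a y ∈ H},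
      ∀ H, ((E H).1 : Subgroup G₂) = H.1.map e.toMonoidHom := by
  -- `e(H)` has the three properties
  have hcard : ∀ H : Subgroup G₁, Nat.card (H.map e.toMonoidHom) = Nat.card H := fun H =>
    (Nat.card_congr (e.subgroupMap H).toEquiv).symm
  have hcard' : ∀ H : Subgroup G₂, Nat.card (H.map e.symm.toMonoidHom) = Nat.card H := fun H =>
    (Nat.card_congr (e.symm.subgroupMap H).toEquiv).symm
  have hf' : ∀ a y, e.symm (f₂ a y) = f₁ a (e.symm y) := fun a y => by
    apply e.injective
    rw [e.apply_symm_apply, hf, e.apply_symm_apply]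
  have hp' : ∀ y, p₂ y ↔ p₁ (e.symm y) := fun y => by rw [hp, e.apply_symm_apply]
  refine ⟨
    { toFun := fun H => ⟨H.1.map e.toMonoidHom, (hcard H.1).trans H.2.1, fun y hy => ?_, fun a y hy => ?_⟩
      invFun := fun H => ⟨H.1.map e.symm.toMonoidHom, (hcard' H.1).trans H.2.1, fun x hx => ?_, fun a x hx => ?_⟩
      left_inv := fun H => ?_
      right_inv := fun H => ?_ }, fun H => rfl⟩
  · rw [Subgroup.mem_map_equiv] at hy
    exact (hp' y).2 (H.2.2.1 _ hy)
  · rw [map_mem_iff_of_semiconj e f₁ f₂ hf]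
    rw [Subgroup.mem_map_equiv] at hy
    exact H.2.2.2 a _ hy
  · rw [Subgroup.mem_map_equiv, MulEquiv.symm_symm] at hx
    exact (hp x).2 (H.2.2.1 _ hx)
  · rw [map_mem_iff_of_semiconj e.symm f₂ f₁ hf', MulEquiv.symm_symm]
    rw [Subgroup.mem_map_equiv, MulEquiv.symm_symm] at hx
    exact H.2.2.2 a _ hx
  · apply Subtype.ext
    ext x
    change x ∈ (H.1.map e.toMonoidHom).map e.symm.toMonoidHom ↔ x ∈ H.1
    rw [Subgroup.mem_map_equiv, MulEquiv.symm_symm, Subgroup.mem_map_equiv, e.symm_apply_apply]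
  · apply Subtype.ext
    ext y
    change y ∈ (H.1.map e.symm.toMonoidHom).map e.toMonoidHom ↔ y ∈ H.1
    rw [Subgroup.mem_map_equiv, Subgroup.mem_map_equiv, MulEquiv.symm_symm, e.apply_symm_apply]

include hf hp in
/-- **EQUAL COUNTS**: the two carriers have the same number of elements (e.g. `#LineOf = q + 1` moves along the iso of fibres).
[cite: Tate1997FiniteFlatGroupSchemes, (3.7)] -/
theorem natCard_stableSubgroups_congr (r : ℕ) :
    Nat.card {H : Subgroup G₁ // Nat.card H = r ∧ (∀ x ∈ H, p₁ x) ∧ ∀ a, ∀ x ∈ H, f₁ a x ∈ H} =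
      Nat.card {H : Subgroup G₂ // Nat.card H = r ∧ (∀ y ∈ H, p₂ y) ∧ ∀ a, ∀ y ∈ H, f₂ a y ∈ H} := by
  obtain ⟨E, -⟩ := exists_equiv_stableSubgroups_map e f₁ f₂ hf p₁ p₂ hp r
  exact Nat.card_congr E

include hf hp in
/-- **«ANOTHER ONE» TRANSPORTS**: if on the `G₁` side every admissible subgroup has an admissible partner different from it, then so on the `G₂` side
(the `htwo` input of ★ SP-SURJ `AdmissibleIdealSpecialFibreSurjective` moves along the iso of fibres). [cite: Tate1997FiniteFlatGroupSchemes, (3.7)] -/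
theorem exists_stableSubgroup_ne_congr (r : ℕ)
    (h : ∀ H₀ : Subgroup G₁, ∃ H : Subgroup G₁, (Nat.card H = r ∧ (∀ x ∈ H, p₁ x) ∧ ∀ a, ∀ x ∈ H, f₁ a x ∈ H) ∧ H ≠ H₀)
    (K₀ : Subgroup G₂) :
    ∃ K : Subgroup G₂, (Nat.card K = r ∧ (∀ y ∈ K, p₂ y) ∧ ∀ a, ∀ y ∈ K, f₂ a y ∈ K) ∧ K ≠ K₀ := by
  obtain ⟨E, hE⟩ := exists_equiv_stableSubgroups_map e f₁ f₂ hf p₁ p₂ hp r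
  obtain ⟨H, hH, hne⟩ := h (K₀.map e.symm.toMonoidHom)
  refine ⟨(E ⟨H, hH⟩).1, (E ⟨H, hH⟩).2, fun hK => hne ?_⟩
  rw [hE] at hK
  change H.map e.toMonoidHom = K₀ at hK
  rw [← hK]
  ext x
  rw [Subgroup.mem_map_equiv, MulEquiv.symm_symm, Subgroup.mem_map_equiv, e.symm_apply_apply]

end StableSubgroups

end Literature.GroupTheory
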